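import Summits.BirchSwinnertonDyer.Rank1Residual.Additive.CensusQ6RankOneInterlock
import Summits.BirchSwinnertonDyer.Rank1Residual.Additive.CongruentPartnerMainConjectureGordBSD
import Summits.BirchSwinnertonDyer.Rank1Residual.Additive.GordRankOneKatoUpperBound
import HarnessLib

/-!
# Census records at an arbitrary index: the COEFFICIENT-VALUATION record `‖[T^k](ϖ·B)‖_p = p^{−v}`
# (column `v_k` of the Q6 / D-ii / X4-2 tables) and the index-`n₀` INTERLOCK — a Q6 record with first
# unit index `n₀` IS p10's Route-G certificate `BranchUnitCoeffAt W p n₀` (cell `b2b-bsdres`, census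
# cell `bsd-formula-census`, seat `b2b-bsdres-census-ctyper1` = conjecture-typer 1, gen 4; n1011
# ROUTE-2 §II.12 sub-target T-E3g (iv); H-9 / Q6 format p253484, rank-one interlock p255810)

HONEST FRAMING (cell `b2b-bsdres`, run/shared/lean/b2b/bsd-rank1-residual/, verbatim in every
file): the goal of the cell is to DELETE the COMBINATION-SHAPED residual classes of the
Birch–Swinnerton-Dyer formula for ALL analytic-rank `≤ 1` elliptic curves over `ℚ` — "full BSD
formula for every rank `≤ 1` curve in class `C`" assembled STRICTLY from published theorems — so
that the rank-`≤ 1` remainder becomes exactly the CONSTRUCTION-SHAPED classes, which are TYPED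
(missing-input `Prop`s), NOT attempted. This is not "finishing BSD". Census cell
(bsd-formula-census): research instrumentation; a coefficient-valuation record is
CERTIFICATE-EVIDENCE (instrumentation tier: a finite `p`-adic computation reported by two engines),
NEVER a Literature fact and never a kernel theorem; labels / RESIDUAL-MAP marks UNCHANGED (O7 OPEN,
X4♯(G-ord) CONSTRUCTION-SHAPED); nothing booked. TWO definitions (record SHAPES = predicates with
parameters, nothing asserted) and theorems; NO named fact, NO conjecture node; the named facts enter
as HYPOTHESES (`hK` Kato 2004 Thm. 17.4 (3) half-eigen reading, `hPal`, `hDel98`, `hDel`, `hDel3`,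
modularity, GZK) exactly as in the consumers quoted by name.

## What (n1011-r2 GEN 6, ROUTE-2.md §II.12 / INBOX 2026-08-21T08:22Z, T-E3g (iv))

The Q6 record `CensusQ6.GordFirstUnitIndexAt W p n₀` (p253484) types "`‖c_m‖_p < 1` for `m < n₀` and
`‖c_{n₀}‖_p = 1`" for the Néron-normalised branch `ϖ·B_{(p−1)/2}(f♭, α♭)`; the rank-one interlock
(p255810) turned the record at `n₀ = 1` into additive-p2's certificate. Route G (n1011-p10,
`CongruentPartnerMainConjectureGord.lean`, def of record `BranchUnitCoeffAt W p b`) is RANK-AGNOSTIC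
and indexed by `b`; this file supplies:
* §0 the record SHAPES `CensusQ6.GordCoeffValAt W p k v` / `CensusQ6.MultCoeffValAt W p k v`
  ("`‖[T^k](ϖ·B^{±}_{(p−1)/2})‖_p = p^{−v}`", `v ∈ ℤ`; parity-uniform, in p10's resp. n1011-p07's
  certificate currency) — the EXACT valuation column `v_k` the Q6 record does not carry (it types
  `v_m ≥ 1` below `n₀`, not `v_m`), in particular `v₁ = v_p(c₁(ϖB))`, the input of the rank-one rider
  (`c₁ ≠ 0`) and of the X4-2 cross-reading `vReg_x42(v₁)` (sequel `CensusX42CoeffValuation.lean`);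
* §1 API: `‖t‖ = p^{−v} ⟺ t ≠ 0 ∧ v(t) = v`; `GordCoeffValAt W p k 0 ⟺ BranchUnitCoeffAt W p k`;
  any value at index `1` ⟹ additive-p2's weak certificate `BranchCoeffOneNeZeroAt W p` (`c₁ ≠ 0`);
  value `0` at index `1` + `L(E,1) = 0` ⟹ the rank-one certificates (Gord: additive-p2; (M): p07);
* §2 the INDEX-`n₀` INTERLOCKS `branchUnitCoeffAt_of_gordFirstUnitIndexAt` (`p ≡ 1 (mod 4)`) and
  `branchUnitCoeffAt_of_gordOddFirstUnitIndexAt` (`p ≡ 3 (mod 4)`, `p = 3` included):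
  `CensusQ6.Gord[Odd]FirstUnitIndexAt W p n₀ → BranchUnitCoeffAt W p n₀` (no `L(E,1)`, no Pal: the
  index-`b` certificate has no constant-term clause), and conversely a full value table
  (`v_m ≥ 1` for `m < n₀`, `v_{n₀} = 0`) ⟹ the Q6 record;
* §3 the record-fed Route-G consumers BY NAME (p10 K-OUT p255527, `…GordBSD.lean`): Kato half + Q6
  record at `n₀` + `BudgetLeLambdaAt p W n₀` ⟹ `ChiBranchLowerDivisibility[Odd]At W p` (the Λ-adic
  LOWER node is a THEOREM at the pair) and, in rank `0` off the anomalous rows, `BSD(E,p)` (`p ≥ 5`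
  both parities; `p = 3`).
EVIDENCE-conditional on the census record and the budget input; nothing asserted about any curve.

References: B. Mazur, J. Tate, J. Teitelbaum, Invent. Math. 84 (1986) §I.10, §I.13–14
[MazurTateTeitelbaum1986Invent]; K. Kato, Astérisque 295 (2004) Thm. 17.4 (3) [Kato2004Asterisque];
M. Emerton, R. Pollack, T. Weston, Invent. Math. 163 (2006) Cor. 3.2.5 [EmertonPollackWeston2006];
D. Delbourgo, Compos. Math. 1998 Prop. 4 [Delbourgo1998]; D. Delbourgo, J. Number Theory 95 (2002)
Thm. (A)/(B) [Delbourgo2002]; A. Pal, Proc. AMS 140 (2012) Thm. 3.2 [Pal2012]; R. L. Miller, LMS J.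
Comput. Math. 14 (2011) Def. 1.1 [Miller2011LMS]; registers HOME/cells/n1011/PREDICTIONS-Q6.md,
PREDICTIONS-KURREG.md, ROUTE-2.md §II.12 (EVIDENCE / planning documents).
-/

set_option autoImplicit false

noncomputable section

open scoped Classical MatrixGroups ModularForm NumberField

open CongruenceSubgroup WeierstrassCurve NumberField Literature.NumberTheory.EllipticCurves
  Literature.NumberTheory.EllipticCurves.ModularForms
  Literature.NumberTheory.EllipticCurves.Rank1Residual
  Literature.NumberTheory.EllipticCurves.Rank1Residual.Typed
  Literature.NumberTheory.EllipticCurves.Delbourgo2002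
  Literature.NumberTheory.GaloisRepresentations
  Literature.NumberTheory.EllipticCurves.Wuthrich2014
  Summit.BirchSwinnertonDyer.Rank1Residual.AdditivePotMult
  Summit.BirchSwinnertonDyer.Rank1Residual.Iwasawa
  IsDedekindDomain

namespace Summit.BirchSwinnertonDyer.Rank1Residual.Additive

namespace CensusQ6

/-! ### §0 The coefficient-valuation record shapes (predicates; nothing asserted) -/

/-- **Census record (G-ord), column `v_k`: `‖[T^k](ϖ · B_{(p−1)/2}(f♭, α♭))‖_p = p^{−v}`** for EVERY
globally minimal `V` ordinary at `p` with `C • V^{(p*)} = W` (`p* = (−1)^{⌊p/2⌋} p`; intended `V = E♭`),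
every newform `f` of `V` and every period ratio `ϖ` of the parity of `(p−1)/2` (`ϖ·Ω_V = Ω⁺_f` resp.
`ϖ·|Ω⁻_V| = Ω⁻_f`) — parity-uniform, in the currency of p10's `BranchUnitCoeffAt` (which is the value
`v = 0`, `gordCoeffValAt_zero_iff`). A finite `p`-adic computation per pair (two-engine rule);
CERTIFICATE-EVIDENCE; a predicate on `(W, p, k, v)`, nothing asserted.
[cite: MazurTateTeitelbaum1986Invent, §I.13 (the branch series; nothing asserted)] -/
def GordCoeffValAt (W : WeierstrassCurve ℚ) (p : ℕ) [Fact p.Prime] (k : ℕ) (v : ℤ) : Prop :=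
  ∀ (V : WeierstrassCurve ℚ) [V.IsElliptic] [V.IsGloballyMinimal] (C : VariableChange ℚ),
    C • V.quadraticTwist ((-1 : ℚ) ^ (p / 2) * p) = W → IsOrdinaryAt V p →
    ∀ {N : ℕ} [NeZero N] (f : CuspForm (Gamma0 N) 2), IsNewformOf V f →
    ∀ ϖ : ℚ, (if Even (p / 2) then (ϖ : ℝ) * V.realPeriodRat = plusPeriod f
        else (ϖ : ℝ) * V.imaginaryPeriodRat = minusPeriod f) →
      ‖PowerSeries.coeff k (PowerSeries.C (ϖ : ℚ_[p]) *
          (if Even (p / 2) then padicLFunctionBranch f ((unitRoot V p : ℤ_[p]) : ℚ_[p]) (p / 2)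
            else padicLFunctionMinusBranch f ((unitRoot V p : ℤ_[p]) : ℚ_[p]) (p / 2)))‖ =
        (p : ℝ) ^ (-v)

/-- **Census record (M), column `v_k`: `‖[T^k](ϖ · L_p^{±}(f♭, ã, ω^{(p−1)/2}))‖_p = p^{−v}`** for EVERY
globally minimal `V` MULTIPLICATIVE at `p` with `C • V^{(p*)} = W`, every newform `f` of `V`,
`a_p(f) = ap` (`= ±1`) and every period ratio `ϖ` of the parity of `(p−1)/2` — parity-uniform, in the
currency of n1011-p07's `MultBranchUnitCertificateAt`. CERTIFICATE-EVIDENCE; a predicate on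
`(W, p, k, v)`, nothing asserted. [cite: MazurTateTeitelbaum1986Invent, §I.10, §I.13 (the branch series; nothing asserted)] -/
def MultCoeffValAt (W : WeierstrassCurve ℚ) (p : ℕ) [Fact p.Prime] (k : ℕ) (v : ℤ) : Prop :=
  ∀ (V : WeierstrassCurve ℚ) [V.IsElliptic] [V.IsGloballyMinimal] (C : VariableChange ℚ),
    Mult V p → C • V.quadraticTwist ((-1 : ℚ) ^ (p / 2) * p) = W →
    ∀ {N : ℕ} [NeZero N] (f : CuspForm (Gamma0 N) 2), IsNewformOf V f → ∀ (ap : ℤ), cuspCoeff f p = ap →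
    ∀ ϖ : ℚ, (if Even (p / 2) then (ϖ : ℝ) * V.realPeriodRat = plusPeriod f
        else (ϖ : ℝ) * V.imaginaryPeriodRat = minusPeriod f) →
      ‖PowerSeries.coeff k (PowerSeries.C (ϖ : ℚ_[p]) *
          (if Even (p / 2) then padicLFunctionPlusBranchMult f (ap : ℚ_[p]) (p / 2)
            else padicLFunctionMinusBranchMult f (ap : ℚ_[p]) (p / 2)))‖ = (p : ℝ) ^ (-v)

variable {W : WeierstrassCurve ℚ} {p : ℕ} [hp : Fact p.Prime]

/-! ### §1 API -/

omit hp in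
/-- `‖t‖_p = p^{−v}` iff `t ≠ 0` and `v_p(t) = v`. [folklore] -/
theorem norm_eq_zpow_neg_iff [Fact p.Prime] {t : ℚ_[p]} {v : ℤ} :
    ‖t‖ = (p : ℝ) ^ (-v) ↔ t ≠ 0 ∧ t.valuation = v := by
  have hp1 : (1 : ℝ) < p := by exact_mod_cast (Fact.out : p.Prime).one_lt
  have hp0 : (0 : ℝ) < p := by positivity
  constructor
  · intro h
    have ht : t ≠ 0 := by
      intro h0
      rw [h0, norm_zero] at h
      exact (zpow_pos hp0 _).ne' h.symm
    refine ⟨ht, ?_⟩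
    have h1 := Padic.norm_eq_zpow_neg_valuation ht
    rw [h] at h1
    have := zpow_right_injective₀ hp0 hp1.ne' h1
    omega
  · rintro ⟨ht, hv⟩
    rw [Padic.norm_eq_zpow_neg_valuation ht, hv]

/-- **Value `0` at index `k` IS p10's index-`k` certificate**: `GordCoeffValAt W p k 0 ⟺
BranchUnitCoeffAt W p k`. [cite: MazurTateTeitelbaum1986Invent, §I.13] -/
theorem gordCoeffValAt_zero_iff {k : ℕ} : GordCoeffValAt W p k 0 ↔ BranchUnitCoeffAt W p k := by
  simp only [GordCoeffValAt, BranchUnitCoeffAt, neg_zero, zpow_zero]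

/-- A (G-ord) record gives, pointwise, a NON-ZERO coefficient of valuation `v` (the rank-one rider's
input `c₁ ≠ 0` is the case `k = 1`). [cite: MazurTateTeitelbaum1986Invent, §I.13] -/
theorem GordCoeffValAt.coeff_ne_zero_and_valuation_eq {k : ℕ} {v : ℤ} (h : GordCoeffValAt W p k v)
    (V : WeierstrassCurve ℚ) [V.IsElliptic] [V.IsGloballyMinimal] (C : VariableChange ℚ)
    (hC : C • V.quadraticTwist ((-1 : ℚ) ^ (p / 2) * p) = W) (hord : IsOrdinaryAt V p)
    {N : ℕ} [NeZero N] (f : CuspForm (Gamma0 N) 2) (hf : IsNewformOf V f) (ϖ : ℚ)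
    (hϖ : if Even (p / 2) then (ϖ : ℝ) * V.realPeriodRat = plusPeriod f
      else (ϖ : ℝ) * V.imaginaryPeriodRat = minusPeriod f) :
    PowerSeries.coeff k (PowerSeries.C (ϖ : ℚ_[p]) *
        (if Even (p / 2) then padicLFunctionBranch f ((unitRoot V p : ℤ_[p]) : ℚ_[p]) (p / 2)
          else padicLFunctionMinusBranch f ((unitRoot V p : ℤ_[p]) : ℚ_[p]) (p / 2))) ≠ 0 ∧
      (PowerSeries.coeff k (PowerSeries.C (ϖ : ℚ_[p]) *
        (if Even (p / 2) then padicLFunctionBranch f ((unitRoot V p : ℤ_[p]) : ℚ_[p]) (p / 2)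
          else padicLFunctionMinusBranch f ((unitRoot V p : ℤ_[p]) : ℚ_[p]) (p / 2)))).valuation =
        v :=
  norm_eq_zpow_neg_iff.mp (h V C hC hord f hf ϖ hϖ)

/-- **The valuation record at index `1` (any `v₁`) IS additive-p2's WEAK certificate
`BranchCoeffOneNeZeroAt W p`** (`[T¹](ϖ·B) ≠ 0` — the rank-one rider's input, n1011 T-E3g (ii); the
`hne` binder of p01's index-`b` capstones). [cite: MazurTateTeitelbaum1986Invent, §I.13] -/
theorem branchCoeffOneNeZeroAt_of_gordCoeffValAt_one {v : ℤ} (h : GordCoeffValAt W p 1 v) :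
    BranchCoeffOneNeZeroAt W p :=
  fun V _ _ C hC hord _ _ f hf ϖ hϖ ↦ (h.coeff_ne_zero_and_valuation_eq V C hC hord f hf ϖ hϖ).1

/-- A (M) record gives, pointwise, a NON-ZERO coefficient of valuation `v`.
[cite: MazurTateTeitelbaum1986Invent, §I.10, §I.13] -/
theorem MultCoeffValAt.coeff_ne_zero_and_valuation_eq {k : ℕ} {v : ℤ} (h : MultCoeffValAt W p k v)
    (V : WeierstrassCurve ℚ) [V.IsElliptic] [V.IsGloballyMinimal] (C : VariableChange ℚ)
    (hV : Mult V p) (hC : C • V.quadraticTwist ((-1 : ℚ) ^ (p / 2) * p) = W)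
    {N : ℕ} [NeZero N] (f : CuspForm (Gamma0 N) 2) (hf : IsNewformOf V f) (ap : ℤ)
    (hap : cuspCoeff f p = ap) (ϖ : ℚ)
    (hϖ : if Even (p / 2) then (ϖ : ℝ) * V.realPeriodRat = plusPeriod f
      else (ϖ : ℝ) * V.imaginaryPeriodRat = minusPeriod f) :
    PowerSeries.coeff k (PowerSeries.C (ϖ : ℚ_[p]) *
        (if Even (p / 2) then padicLFunctionPlusBranchMult f (ap : ℚ_[p]) (p / 2)
          else padicLFunctionMinusBranchMult f (ap : ℚ_[p]) (p / 2))) ≠ 0 ∧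
      (PowerSeries.coeff k (PowerSeries.C (ϖ : ℚ_[p]) *
        (if Even (p / 2) then padicLFunctionPlusBranchMult f (ap : ℚ_[p]) (p / 2)
          else padicLFunctionMinusBranchMult f (ap : ℚ_[p]) (p / 2)))).valuation = v :=
  norm_eq_zpow_neg_iff.mp (h V C hV hC f hf ap hap ϖ hϖ)

/-- **The (M) valuation record at index `1` (any `v₁`) IS n1011-p07's census-literal binder `hne`**
of `ClassX4M.forall_schneider_of_katoHalf_of_multCoeffOneNeZero` and the T-E3gM capstones (p257344;
the interlock p07-g3 left 'at the typer's word'). [cite: MazurTateTeitelbaum1986Invent, §I.10, §I.13] -/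
theorem multCoeffOneNeZero_of_multCoeffValAt_one {v : ℤ} (h : MultCoeffValAt W p 1 v) :
    ∀ (V : WeierstrassCurve ℚ) [V.IsElliptic] [V.IsGloballyMinimal] (C : VariableChange ℚ),
      Mult V p → C • V.quadraticTwist ((-1 : ℚ) ^ (p / 2) * p) = W →
      ∀ {N : ℕ} [NeZero N] (f : CuspForm (Gamma0 N) 2), IsNewformOf V f → ∀ (ap : ℤ),
      cuspCoeff f p = ap →
      ∀ ϖ : ℚ, (if Even (p / 2) then (ϖ : ℝ) * V.realPeriodRat = plusPeriod f
          else (ϖ : ℝ) * V.imaginaryPeriodRat = minusPeriod f) →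
        PowerSeries.coeff 1 (PowerSeries.C (ϖ : ℚ_[p]) *
            (if Even (p / 2) then padicLFunctionPlusBranchMult f (ap : ℚ_[p]) (p / 2)
              else padicLFunctionMinusBranchMult f (ap : ℚ_[p]) (p / 2))) ≠ 0 :=
  fun V _ _ C hV hC _ _ f hf ap hap ϖ hϖ ↦ (h.coeff_ne_zero_and_valuation_eq V C hV hC f hf ap hap ϖ hϖ).1

/-- **Value `0` at index `1` + `L(E,1) = 0` ⟹ additive-p2's rank-one certificate
`BranchUnitCertificateAt W p`** (`branchUnitCertificateAt_of_norm_coeff_one`; constant term `0` by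
interpolation, Birch + Pal). [cite: MazurTateTeitelbaum1986Invent, §I.13] [cite: Pal2012, Thm. 3.2] -/
theorem branchUnitCertificateAt_of_gordCoeffValAt_one_zero [W.IsElliptic] [W.IsGloballyMinimal]
    (hPal : Pal2012.thm32_sqrt_mul_realPeriodRat_twist_eq_of_prime_one_mod_four)
    (hmod : hasEntireLFunction_rat) (hp2 : p ≠ 2) (hadd : Addv W p) (hL : W.entireLFunction 1 = 0)
    (h : GordCoeffValAt W p 1 0) : BranchUnitCertificateAt W p :=
  branchUnitCertificateAt_of_norm_coeff_one hPal hmod hp2 hadd hL fun V _ _ C hC hord _ _ f hf ϖ hϖ ↦ by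
    simpa only [neg_zero, zpow_zero] using h V C hC hord f hf ϖ hϖ

/-- **(M): value `0` at index `1` + `L(E,1) = 0` ⟹ n1011-p07's `MultBranchUnitCertificateAt W p`**
(`multBranchUnitCertificateAt_of_norm_coeff_one`). [cite: MazurTateTeitelbaum1986Invent, §I.10, §I.13]
[cite: Pal2012, Thm. 3.2] -/
theorem multBranchUnitCertificateAt_of_multCoeffValAt_one_zero [W.IsElliptic] [W.IsGloballyMinimal]
    (hPal : Pal2012.thm32_sqrt_mul_realPeriodRat_twist_eq_of_prime_one_mod_four)
    (hmod : hasEntireLFunction_rat) (hp2 : p ≠ 2) (hadd : Addv W p) (hL : W.entireLFunction 1 = 0)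
    (h : MultCoeffValAt W p 1 0) : MultBranchUnitCertificateAt W p :=
  multBranchUnitCertificateAt_of_norm_coeff_one hPal hmod hp2 hadd hL
    fun V _ _ C hV hC _ _ f hf ap hap ϖ hϖ ↦ by
      simpa only [neg_zero, zpow_zero] using h V C hV hC f hf ap hap ϖ hϖ

/-! ### §2 The index-`n₀` interlocks: Q6 record ⟺ p10's `BranchUnitCoeffAt W p n₀` (+ the lower columns) -/

/-- **INTERLOCK (G-ord), `p ≡ 1 (mod 4)`: `CensusQ6.GordFirstUnitIndexAt W p n₀ → BranchUnitCoeffAt W p n₀`**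
— a Q6 record with first unit index `n₀` IS Route G's index-`n₀` certificate (no `L(E,1)`, no Pal
needed: the index-`b` certificate has no constant-term clause). Makes EVERY `…_of_coeffCert_of_budget`
/ `…_of_congruentPartner` theorem of p10 applicable to a Q6 row. [cite: MazurTateTeitelbaum1986Invent, §I.13] -/
theorem branchUnitCoeffAt_of_gordFirstUnitIndexAt (hp4 : p % 4 = 1) {n₀ : ℕ}
    (hrec : GordFirstUnitIndexAt W p n₀) : BranchUnitCoeffAt W p n₀ := by
  intro V _ _ C hC hord N _ f hf ϖ hϖ
  have heven : Even (p / 2) := ⟨p / 4, by omega⟩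
  have hC' : C • V.quadraticTwist (p : ℚ) = W := by
    rw [pStar_eq_self_of_mod_four_eq_one hp4] at hC; exact hC
  rw [if_pos heven] at hϖ ⊢
  exact (hrec V C hord hC' f hf ϖ hϖ).2

/-- **INTERLOCK (G-ord), `p ≡ 3 (mod 4)` (`p = 3` included): `CensusQ6.GordOddFirstUnitIndexAt W p n₀ →
BranchUnitCoeffAt W p n₀`.** [cite: MazurTateTeitelbaum1986Invent, §I.13] -/
theorem branchUnitCoeffAt_of_gordOddFirstUnitIndexAt (hp4 : p % 4 = 3) {n₀ : ℕ}
    (hrec : GordOddFirstUnitIndexAt W p n₀) : BranchUnitCoeffAt W p n₀ := by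
  intro V _ _ C hC hord N _ f hf ϖ hϖ
  have hodd : ¬ Even (p / 2) := by rw [Nat.not_even_iff_odd]; exact ⟨p / 4, by omega⟩
  have hC' : C • V.quadraticTwist (-(p : ℚ)) = W := by
    rw [pStar_eq_neg_of_mod_four_eq_three hp4] at hC; exact hC
  rw [if_neg hodd] at hϖ ⊢
  exact (hrec V C hord hC' f hf ϖ hϖ).2

/-- Record ⟹ value `0` at index `n₀` (`p ≡ 1 (mod 4)`). [cite: MazurTateTeitelbaum1986Invent, §I.13] -/
theorem gordCoeffValAt_zero_of_gordFirstUnitIndexAt (hp4 : p % 4 = 1) {n₀ : ℕ}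
    (hrec : GordFirstUnitIndexAt W p n₀) : GordCoeffValAt W p n₀ 0 :=
  gordCoeffValAt_zero_iff.mpr (branchUnitCoeffAt_of_gordFirstUnitIndexAt hp4 hrec)

/-- Record ⟹ value `0` at index `n₀` (`p ≡ 3 (mod 4)`). [cite: MazurTateTeitelbaum1986Invent, §I.13] -/
theorem gordCoeffValAt_zero_of_gordOddFirstUnitIndexAt (hp4 : p % 4 = 3) {n₀ : ℕ}
    (hrec : GordOddFirstUnitIndexAt W p n₀) : GordCoeffValAt W p n₀ 0 :=
  gordCoeffValAt_zero_iff.mpr (branchUnitCoeffAt_of_gordOddFirstUnitIndexAt hp4 hrec)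

omit hp in
/-- `‖t‖ = p^{−v}` with `0 < v` ⟹ `‖t‖ < 1`. [folklore] -/
private theorem norm_lt_one_of_norm_eq_zpow_neg [Fact p.Prime] {t : ℚ_[p]} {v : ℤ}
    (h : ‖t‖ = (p : ℝ) ^ (-v)) (hv : 0 < v) : ‖t‖ < 1 := by
  have hp1 : (1 : ℝ) < p := by exact_mod_cast (Fact.out : p.Prime).one_lt
  rw [h]
  exact zpow_lt_one_of_neg₀ hp1 (by omega)

/-- **A full value table gives the Q6 record (`p ≡ 1 (mod 4)`)**: columns `v_m ≥ 1` for `m < n₀` and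
`v_{n₀} = 0` ⟹ `CensusQ6.GordFirstUnitIndexAt W p n₀`. [cite: MazurTateTeitelbaum1986Invent, §I.13] -/
theorem gordFirstUnitIndexAt_of_gordCoeffValAt (hp4 : p % 4 = 1) {n₀ : ℕ}
    (hlt : ∀ m < n₀, ∃ v : ℤ, 0 < v ∧ GordCoeffValAt W p m v) (h0 : GordCoeffValAt W p n₀ 0) :
    GordFirstUnitIndexAt W p n₀ := by
  intro V _ _ C hV hC N _ f hf ϖ hϖ
  have heven : Even (p / 2) := ⟨p / 4, by omega⟩
  have hC' : C • V.quadraticTwist ((-1 : ℚ) ^ (p / 2) * p) = W := by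
    rw [pStar_eq_self_of_mod_four_eq_one hp4]; exact hC
  have hϖ' : (if Even (p / 2) then (ϖ : ℝ) * V.realPeriodRat = plusPeriod f
      else (ϖ : ℝ) * V.imaginaryPeriodRat = minusPeriod f) := by rw [if_pos heven]; exact hϖ
  refine ⟨fun m hm ↦ ?_, ?_⟩
  · obtain ⟨v, hv, h⟩ := hlt m hm
    have := h V C hC' hV f hf ϖ hϖ'
    rw [if_pos heven] at this
    exact norm_lt_one_of_norm_eq_zpow_neg this hv
  · have := h0 V C hC' hV f hf ϖ hϖ'
    rw [if_pos heven, neg_zero, zpow_zero] at this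
    exact this

/-- **A full value table gives the Q6 record (`p ≡ 3 (mod 4)`)**.
[cite: MazurTateTeitelbaum1986Invent, §I.13] -/
theorem gordOddFirstUnitIndexAt_of_gordCoeffValAt (hp4 : p % 4 = 3) {n₀ : ℕ}
    (hlt : ∀ m < n₀, ∃ v : ℤ, 0 < v ∧ GordCoeffValAt W p m v) (h0 : GordCoeffValAt W p n₀ 0) :
    GordOddFirstUnitIndexAt W p n₀ := by
  intro V _ _ C hV hC N _ f hf ϖ hϖ
  have hodd : ¬ Even (p / 2) := by rw [Nat.not_even_iff_odd]; exact ⟨p / 4, by omega⟩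
  have hC' : C • V.quadraticTwist ((-1 : ℚ) ^ (p / 2) * p) = W := by
    rw [pStar_eq_neg_of_mod_four_eq_three hp4]; exact hC
  have hϖ' : (if Even (p / 2) then (ϖ : ℝ) * V.realPeriodRat = plusPeriod f
      else (ϖ : ℝ) * V.imaginaryPeriodRat = minusPeriod f) := by rw [if_neg hodd]; exact hϖ
  refine ⟨fun m hm ↦ ?_, ?_⟩
  · obtain ⟨v, hv, h⟩ := hlt m hm
    have := h V C hC' hV f hf ϖ hϖ'
    rw [if_neg hodd] at this
    exact norm_lt_one_of_norm_eq_zpow_neg this hv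
  · have := h0 V C hC' hV f hf ϖ hϖ'
    rw [if_neg hodd, neg_zero, zpow_zero] at this
    exact this

end CensusQ6

open CensusQ6

variable {W : WeierstrassCurve ℚ} [W.IsElliptic] [W.IsGloballyMinimal] {p : ℕ} [hp : Fact p.Prime]

/-! ### §3 Route G on a Q6 row (n1011-p10's K-OUT and rank-`0` ends, BY NAME, fed by §2) -/

/-- **X4♯(G-ord) ∩ `I₀*` ∩ {`ρ̄` onto}, `p ≡ 1 (mod 4)`: Kato half + Q6 record at `n₀` +
`BudgetLeLambdaAt p W n₀` ⟹ the Λ-adic LOWER node `ChiBranchLowerDivisibilityAt W p` HOLDS at the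
pair** (p10's `…_of_katoHalf_of_coeffCert_of_budget` ∘ §2). [cite: Kato2004Asterisque, Thm. 17.4 (3) (p. 273)]
[cite: EmertonPollackWeston2006, Cor. 3.2.5 (source of the budget input)] -/
theorem ClassX4Gord.chiBranchLowerDivisibilityAt_of_katoHalf_of_gordFirstUnitIndexAt_of_budget
    (hK : Wuthrich2014.kato_halfEigenCharIdeal_dvd_cyclotomicPrime_of_surjective)
    (hX : ClassX4Gord W p) (he : semistabilityIndex W p = 2) (hsurj : Surj W p) (hp4 : p % 4 = 1)
    {n₀ : ℕ} (hrec : GordFirstUnitIndexAt W p n₀) (hbud : BudgetLeLambdaAt p W n₀) :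
    ChiBranchLowerDivisibilityAt W p :=
  hX.chiBranchLowerDivisibilityAt_of_katoHalf_of_coeffCert_of_budget hK he hsurj
    (branchUnitCoeffAt_of_gordFirstUnitIndexAt hp4 hrec) hbud

/-- **X4♯(G-ord) ∩ `I₀*` ∩ {`ρ̄` onto}, `p ≡ 3 (mod 4)` (`p = 3` included): Kato half + Q6 record at
`n₀` + `BudgetLeLambdaAt p W n₀` ⟹ `ChiBranchLowerDivisibilityOddAt W p`.**
[cite: Kato2004Asterisque, Thm. 17.4 (3) (p. 273)] [cite: EmertonPollackWeston2006, Cor. 3.2.5 (source of the budget input)] -/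
theorem ClassX4Gord.chiBranchLowerDivisibilityOddAt_of_katoHalf_of_gordOddFirstUnitIndexAt_of_budget
    (hK : Wuthrich2014.kato_halfEigenCharIdeal_dvd_cyclotomicPrime_of_surjective)
    (hX : ClassX4Gord W p) (he : semistabilityIndex W p = 2) (hsurj : Surj W p) (hp4 : p % 4 = 3)
    {n₀ : ℕ} (hrec : GordOddFirstUnitIndexAt W p n₀) (hbud : BudgetLeLambdaAt p W n₀) :
    ChiBranchLowerDivisibilityOddAt W p :=
  hX.chiBranchLowerDivisibilityOddAt_of_katoHalf_of_coeffCert_of_budget hK he hsurj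
    (branchUnitCoeffAt_of_gordOddFirstUnitIndexAt hp4 hrec) hbud

/-- **X4♯(G-ord) ∩ `I₀*` ∩ {`ρ̄` onto}, `p ≥ 5`, `p ≡ 1 (mod 4)`, `r_an = 0`, non-CM, non-anomalous:
`BSD(E,p)` from the named facts + the Q6 record at `n₀ = B(E,p)` + the budget bound** (p10's
partner-free Route G end `ClassX4Gord.bsdp_rankZero_of_katoHalf_of_coeffCert_of_budget_of_nonAnomalous`).
[cite: Delbourgo2002, Theorem (A), (B) (p. 40)] [cite: Kato2004Asterisque, Thm. 17.4 (3) (p. 273)]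
[cite: Delbourgo1998, Prop. 4 (p. 144)] [cite: Miller2011LMS, §1 and Def. 1.1] -/
theorem ClassX4Gord.bsdp_rankZero_of_katoHalf_of_gordFirstUnitIndexAt_of_budget_of_nonAnomalous
    (hK : Wuthrich2014.kato_halfEigenCharIdeal_dvd_cyclotomicPrime_of_surjective)
    (hPal : Pal2012.thm32_sqrt_mul_realPeriodRat_twist_eq_of_prime_one_mod_four)
    (hDel98 : Delbourgo1998.prop4_rankZero_pow_dvd_constantCoeff) (hDel : Delbourgo2002.mainTheorem)
    (hGZK : rank_eq_analyticRank_of_analyticRank_le_one) (hmod : hasEntireLFunction_rat)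
    (hmodD : nonempty_modularParametrizationData)
    (hX : ClassX4Gord W p) (hcm : ¬ W.HasCM) (hp5 : 5 ≤ p) (hp4 : p % 4 = 1)
    (he : semistabilityIndex W p = 2) (hsurj : Surj W p) (hr : W.analyticRank = 0)
    {n₀ : ℕ} (hrec : GordFirstUnitIndexAt W p n₀) (hbud : BudgetLeLambdaAt p W n₀)
    (hna : ReductionNonAnomalous W p) : BSDp W p :=
  ClassX4Gord.bsdp_rankZero_of_katoHalf_of_coeffCert_of_budget_of_nonAnomalous hK hPal hDel98 hDel hGZK
    hmod hmodD hX hcm hp5 he hsurj hr (branchUnitCoeffAt_of_gordFirstUnitIndexAt hp4 hrec) hbud hna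

/-- **Same, `p ≥ 5`, `p ≡ 3 (mod 4)`** (odd record `CensusQ6.GordOddFirstUnitIndexAt W p n₀`; Pal for
`d < 0` is a tree theorem — `hPal` is carried only for the uniform signature of p10's end).
[cite: Delbourgo2002, Theorem (A), (B) (p. 40)] [cite: Kato2004Asterisque, Thm. 17.4 (3) (p. 273)]
[cite: Delbourgo1998, Prop. 4 (p. 144)] [cite: Miller2011LMS, §1 and Def. 1.1] -/
theorem ClassX4Gord.bsdp_rankZero_of_katoHalf_of_gordOddFirstUnitIndexAt_of_budget_of_nonAnomalous
    (hK : Wuthrich2014.kato_halfEigenCharIdeal_dvd_cyclotomicPrime_of_surjective)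
    (hPal : Pal2012.thm32_sqrt_mul_realPeriodRat_twist_eq_of_prime_one_mod_four)
    (hDel98 : Delbourgo1998.prop4_rankZero_pow_dvd_constantCoeff) (hDel : Delbourgo2002.mainTheorem)
    (hGZK : rank_eq_analyticRank_of_analyticRank_le_one) (hmod : hasEntireLFunction_rat)
    (hmodD : nonempty_modularParametrizationData)
    (hX : ClassX4Gord W p) (hcm : ¬ W.HasCM) (hp5 : 5 ≤ p) (hp4 : p % 4 = 3)
    (he : semistabilityIndex W p = 2) (hsurj : Surj W p) (hr : W.analyticRank = 0)
    {n₀ : ℕ} (hrec : GordOddFirstUnitIndexAt W p n₀) (hbud : BudgetLeLambdaAt p W n₀)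
    (hna : ReductionNonAnomalous W p) : BSDp W p :=
  ClassX4Gord.bsdp_rankZero_of_katoHalf_of_coeffCert_of_budget_of_nonAnomalous hK hPal hDel98 hDel hGZK
    hmod hmodD hX hcm hp5 he hsurj hr (branchUnitCoeffAt_of_gordOddFirstUnitIndexAt hp4 hrec) hbud hna

/-- **X4♯(G-ord) at `3` ∧ surj(3), `r_an = 0`, non-CM, non-anomalous: `BSD(E,3)` from the named facts
(Kato half, Delbourgo 1998 Prop. 4, Delbourgo 2002 AT 3 = `mainTheorem_three`, GZK, modularity) + the Q6
record `CensusQ6.GordOddFirstUnitIndexAt W 3 n₀` (`n₀ = B(E,3)`) + the budget bound** (p10's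
`…bsdp_three_rankZero_of_katoHalf_of_coeffCert_of_budget_of_nonAnomalous`).
[cite: Delbourgo2002, Theorem (A), (B) (p. 40), Hypothesis (p. 39)]
[cite: Kato2004Asterisque, Thm. 17.4 (3) (p. 273)] [cite: Delbourgo1998, Prop. 4 (p. 144)]
[cite: Miller2011LMS, §1 and Def. 1.1] -/
theorem ClassX4Gord.bsdp_three_rankZero_of_katoHalf_of_gordOddFirstUnitIndexAt_of_budget_of_nonAnomalous
    [Fact (Nat.Prime 3)] {W : WeierstrassCurve ℚ} [W.IsElliptic] [W.IsGloballyMinimal]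
    (hK : Wuthrich2014.kato_halfEigenCharIdeal_dvd_cyclotomicPrime_of_surjective)
    (hPal : Pal2012.thm32_sqrt_mul_realPeriodRat_twist_eq_of_prime_one_mod_four)
    (hDel98 : Delbourgo1998.prop4_rankZero_pow_dvd_constantCoeff)
    (hDel3 : Delbourgo2002.mainTheorem_three)
    (hGZK : rank_eq_analyticRank_of_analyticRank_le_one) (hmod : hasEntireLFunction_rat)
    (hmodD : nonempty_modularParametrizationData)
    (hX : ClassX4Gord W 3) (hcm : ¬ W.HasCM) (hsurj : Surj W 3) (hr : W.analyticRank = 0)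
    {n₀ : ℕ} (hrec : GordOddFirstUnitIndexAt W 3 n₀) (hbud : BudgetLeLambdaAt 3 W n₀)
    (hna : ReductionNonAnomalous W 3) : BSDp W 3 :=
  ClassX4Gord.bsdp_three_rankZero_of_katoHalf_of_coeffCert_of_budget_of_nonAnomalous hK hPal hDel98 hDel3
    hGZK hmod hmodD hX hcm hsurj hr (branchUnitCoeffAt_of_gordOddFirstUnitIndexAt (by decide) hrec) hbud
    hna

end Summit.BirchSwinnertonDyer.Rank1Residual.Additive

end
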